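/-
Copyright: statement-level skeleton of a published paper (lit-balaban cell, Phase-2 proof seat p13, gen 6). No proof
claims beyond what the kernel checks below.
-/
import Literature.MathematicalPhysics.QuantumFieldTheory.BalabanImbrieJaffe1984to88.BIJ88Eq248Lattice

/-!
# `BalabanImbrieJaffe1984to88.BIJ88Connected244Lattice` — T. Bałaban, J. Imbrie, A. Jaffe, *Effective action and
cluster properties of the abelian Higgs model*, Commun. Math. Phys. **114** (1988) 257–315 [BalabanImbrieJaffe1988],
§2 (2.44) p. 264 [PDF 8]: **"Let X be a CONNECTED union of r(e_k)-cubes"** — PROVED FOR THE `ℤ^d` OPERATORS OF [6] =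
[Balaban1983RegularityDecay] Sect. 5 (the walk terms `BIJ88Eq242Lattice.latticeCw`) UNDER THE PRINTED FINITE RANGE
(2.37) p. 264 of the operator: the cube region `X(ω)` of every contributing walk is connected, so only connected `X`
carry a part `C^{(k)}_{Λ,X}`.

statement-level skeleton of published theorems with citation tags; proofs where landed; nothing here is a claim
about the Yang–Mills mass gap

PDF held: `paper:balaban1988-cmp114-bij-abelian-higgs-effective-action` (journal page = PDF page + 256; p. 264
read with `lit read … --pages 8`).

CITATION HEADER (lean-in-tree rule).  lit-balaban cell (HOME `run/shared/lean/pub/lit-balaban/`), Phase 2, seat p13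
gen 6 (unit `lit-balaban-p13-g6`); row **C2.Eq2.44** of `HOME/lit-balaban-r18/ROWS-C2.md` (owner r18, referee ref-5;
typed `BIJ88RandomWalk242.cX`, p244240; connectedness for NEAREST-NEIGHBOUR walks `BIJ88RandomWalk242.cX_ne_zero_connected`,
p245461 — whose hypothesis `hNN` the walks of [6] Sect. 5 do NOT meet in general: the pairs `(ω_{2i+1}, ω_{2i+2})` of
(5.17) are arbitrary, `R_{j,j′} = −(1−□_{j′})h_j²Ah_{j′} ≠ 0` for far `j, j′` whenever `A` has nonzero far entries).
Files USED BY NAME, nothing restated: `…BIJ88RandomWalk242` (`Walk`, `Walk.IsNN`, `region`, `cX`, `region_connected`,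
`cX_ne_zero_connected`), `…BIJ88Eq242Lattice` (`flatten`, `latticeCw`), `…BIJ88Ineq246Lattice` (p251520: `LTup`, `term`,
`latticeCw_flatten'`, `dL`, `dL_self`, `pt`, `pt_odd`, `pt_even_succ`, `IsChain`, `isChain_of_term_ne_zero`, `ldist`,
`Cubes`, `cubeOf`, `touch`, `touch_symm`, `dL_ge_of_not_touch`), `…BIJ88WalkGeometry246` (`ptAt`, `ptAt_succ`,
`cons_castSucc_eq_ptAt`), `…BIJ88Eq248Lattice` (`dist_le_of_inBox`), `…B4Sect5CubeBounds` (`labels`, `hfun`,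
`inBox_of_hfun_ne_zero`, `pFam`, `hFam`, `cFam`, `rPair_offDiag_apply`, `Adj`), `…B4Sect5RandomWalk` (`rPair`,
`bFac`, `walkTerm517`), `…B4RandomWalk213` (`bprod`, `bprod_succ`, `IsWalk`).

## The print (verbatim, p. 264)

(2.37): *"Δ_{k,loc}(u; x₁, x₂) = 0, if |x₁ − x₂| ≧ (1/2L)r(e_{k−1})"*.  (2.42)–(2.44): *"C^{(k)}_Λ(u) = Σ_ω C^{(k)}_{Λ,ω}(u),
(2.42) where ω is a walk on a lattice of spacing M = O(1). … Let X be a connected union of r(e_k)-cubes, and let X⁰ be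
the cubes of X not at the boundary of X. We define C^{(k)}_{Λ,X}(u; x₁, x₂) = Σ^X_ω C_ω(x₁, x₂), (2.44)"*.

## What is proved (termwise; ANY `A` of finite range `ρ_A`, any cube size `M ≥ 1`, no (5.6), no convergence)

With cubes `□_j` of side `2M` at the labels `j`, `r(e_k)`-cubes of `s` labels a side (`sM = r(e_k)`), and the FINITE
RANGE hypothesis `A(x, x′) = 0` for `|x − x′|_∞ > ρ_A` (the print's (2.37) for `Δ_{k,loc}(u)`, plus the block range
of `aL^{−2}Q(u)*Q(u)`; stated as a plain hypothesis on `A`):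
* §1–§2 a nonzero off-diagonal pair operator `R_{j,j′}` has a nonzero entry `A(x,x′)` with `x ∈ supp h_j ⊆ □_j`,
  `x′ ∈ supp h_{j′} ⊆ □_{j′}` (`exists_entry_of_rPair_ne_zero`), hence `|j − j′|_∞ ≤ ρ_A/M + 2` (`dL_le_of_rPair_ne_zero`);
  a nonzero walk term has all its pair factors nonzero (`bFac_ne_zero_of_term_ne_zero`).
* §3 **every contributing walk is a walk for the adjacency «labels within `ρ_A/M + 2`»** (`isNN_of_latticeCw_ne_zero`:
  the even steps `(ω_{2i}, ω_{2i+1})` are adjacent labels by [6] (5.17), the odd steps are `R`-pairs).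
* §4 if `ρ_A < (s − 1)M` — range shorter than `r(e_k) − M` — labels within `ρ_A/M + 2` have TOUCHING `r(e_k)`-cubes
  (`touch_of_near`), so **the region `X(ω)` of every contributing walk is connected** (`region_connected_lattice`) and
  **`C_{Λ,X}(x₁, x₂) ≠ 0 ⇒ X` is a connected union of `r(e_k)`-cubes** (`cX_lattice_ne_zero_connected`): the typed sum over
  all `X` in (2.45) is the printed sum over connected `X` (`sum_cX_eq_sum_connected`).
HONEST SCOPE.  Operators of [6] Sect. 5 only (as in `BIJ88Eq242Lattice`); connectedness in the cube graph of `touch`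
(sup-distance of cube labels `≤ 1`), as in p245461; without a finite range (or with `ρ_A ≥ (s−1)M`) the regions of [6]'s
walks need not be connected — then the non-connected `X` simply carry (small) nonzero parts.  No `sorry`; no new `Prop` fact.
-/

namespace Literature.MathematicalPhysics.QuantumFieldTheory.BalabanImbrieJaffe1984to88.BIJ88Connected244Lattice

open scoped BigOperators
open Finset
open Literature.MathematicalPhysics.QuantumFieldTheory.Balaban1983to89
open Literature.MathematicalPhysics.QuantumFieldTheory.BalabanImbrieJaffe1984to88
open B4RandomWalk213 B4Sect5RandomWalk B4Sect5CubeBounds BIJ88RandomWalk242 BIJ88Eq242Lattice BIJ88Ineq246Lattice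
  BIJ88WalkGeometry246 BIJ88Eq248Lattice

open scoped Matrix

variable {d N : ℕ} {Λ : Finset (Fin d → ℤ)} {M : ℕ} {A : Matrix (B4.Idx Λ N) (B4.Idx Λ N) ℝ}

/-! ## §1 A nonzero `R_{j,j′}` sees a nonzero entry of `A` between the two boxes -/

/-- if the off-diagonal pair operator `R_{j,j′} = −(1−□_{j′})h_j²Ah_{j′}` (5.14) is nonzero, some entry `A(x, x′)` with
`h_j(x) ≠ 0`, `h_{j′}(x′) ≠ 0` is nonzero. [cite: Balaban1983RegularityDecay, (5.14) p.595] -/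
theorem exists_entry_of_rPair_ne_zero {j j' : ↥(labels M Λ)} (hjj : j ≠ j')
    (h : rPair A (pFam N M Λ) (hFam N M Λ) j j' ≠ 0) :
    ∃ p q : B4.Idx Λ N, hfun M j.1 (p.1 : Fin d → ℤ) ≠ 0 ∧ hfun M j'.1 (q.1 : Fin d → ℤ) ≠ 0 ∧ A p q ≠ 0 := by
  by_contra hall
  push Not at hall
  apply h
  ext p q
  rw [rPair_offDiag_apply M A hjj, Matrix.zero_apply]
  by_cases h1 : hfun M j.1 (p.1 : Fin d → ℤ) = 0
  · rw [h1]; ring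
  · by_cases h2 : hfun M j'.1 (q.1 : Fin d → ℤ) = 0
    · rw [h2]; ring
    · rw [hall p q h1 h2]; ring

/-- label distance from box distance: `|Mj − Mj′|_∞ ≤ D ⇒ |j − j′|_∞ ≤ D/M`. [cite: Balaban1983RegularityDecay, (5.11) p.594] -/
theorem dL_le_of_dist_smul_le (hM : 0 < M) (j j' : ↥(labels M Λ)) {D : ℝ}
    (h : dist ((M : ℤ) • (j.1 : Fin d → ℤ)) ((M : ℤ) • (j'.1 : Fin d → ℤ)) ≤ D) : dL j j' ≤ D / M := by
  unfold dL
  have hMr : (0 : ℝ) < M := by exact_mod_cast hM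
  have hD : 0 ≤ D := dist_nonneg.trans h
  refine (dist_pi_le_iff (div_nonneg hD hMr.le)).mpr fun μ => ?_
  have hμ := (dist_le_pi_dist ((M : ℤ) • (j.1 : Fin d → ℤ)) ((M : ℤ) • (j'.1 : Fin d → ℤ)) μ).trans h
  rw [Int.dist_eq] at hμ ⊢
  simp only [Pi.smul_apply, smul_eq_mul, Int.cast_mul, Int.cast_natCast] at hμ
  rw [← mul_sub, abs_mul, abs_of_pos hMr] at hμ
  rw [le_div_iff₀ hMr, mul_comm]
  exact hμ

/-- **a nonzero `R_{j,j′}` forces `|j − j′|_∞ ≤ ρ_A/M + 2`** when `A` has finite range `ρ_A` (`A(x,x′) = 0` for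
`|x − x′|_∞ > ρ_A`): the nonzero entry joins `x ∈ □_j` to `x′ ∈ □_{j′}`, and `|x − Mj|_∞, |x′ − Mj′|_∞ ≤ M`.
[cite: BalabanImbrieJaffe1988, (2.37) p.264; Balaban1983RegularityDecay, (5.14) p.595] -/
theorem dL_le_of_rPair_ne_zero (hM : 0 < M) {ρA : ℝ} (hρ : 0 ≤ ρA)
    (hA : ∀ p q : B4.Idx Λ N, ρA < dist (p.1 : Fin d → ℤ) (q.1 : Fin d → ℤ) → A p q = 0)
    {j j' : ↥(labels M Λ)} (h : rPair A (pFam N M Λ) (hFam N M Λ) j j' ≠ 0) : dL j j' ≤ ρA / M + 2 := by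
  have hMr : (0 : ℝ) < M := by exact_mod_cast hM
  by_cases hjj : j = j'
  · subst hjj
    rw [dL_self]
    positivity
  · obtain ⟨p, q, hp, hq, hpq⟩ := exists_entry_of_rPair_ne_zero hjj h
    have hdist : dist (p.1 : Fin d → ℤ) (q.1 : Fin d → ℤ) ≤ ρA := not_lt.mp fun hlt => hpq (hA p q hlt)
    have hpb : dist ((M : ℤ) • (j.1 : Fin d → ℤ)) (p.1 : Fin d → ℤ) ≤ M :=
      dist_le_of_inBox (inBox_of_hfun_ne_zero hM hp)
    have hqb : dist ((M : ℤ) • (j'.1 : Fin d → ℤ)) (q.1 : Fin d → ℤ) ≤ M :=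
      dist_le_of_inBox (inBox_of_hfun_ne_zero hM hq)
    have hD : dist ((M : ℤ) • (j.1 : Fin d → ℤ)) ((M : ℤ) • (j'.1 : Fin d → ℤ)) ≤ ρA + 2 * M := by
      have t1 := dist_triangle ((M : ℤ) • (j.1 : Fin d → ℤ)) (p.1 : Fin d → ℤ) ((M : ℤ) • (j'.1 : Fin d → ℤ))
      have t2 := dist_triangle (p.1 : Fin d → ℤ) (q.1 : Fin d → ℤ) ((M : ℤ) • (j'.1 : Fin d → ℤ))
      rw [dist_comm (q.1 : Fin d → ℤ)] at t2
      linarith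
    have := dL_le_of_dist_smul_le hM j j' hD
    have e : (ρA + 2 * M) / M = ρA / M + 2 := by field_simp
    linarith

/-! ## §2 A nonzero walk term has nonzero pair factors -/

/-- an ordered product with a vanishing factor vanishes. [cite: Balaban1983RegularityDecay, (5.17) p.595] -/
theorem bprod_eq_zero_of_eq_zero {R ι : Type*} [Ring R] (b : ι → R) :
    ∀ (n : ℕ) (ys : Fin n → ι) (i : Fin n), b (ys i) = 0 → bprod b n ys = 0 := by
  intro n
  induction n with
  | zero => intro ys i; exact i.elim0
  | succ n ih =>
      intro ys i hi
      rw [bprod_succ]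
      by_cases h0 : i = 0
      · subst h0
        rw [hi, zero_mul]
      · have hi' : (Fin.tail ys) (i.pred h0) = ys i := by
          simp only [Fin.tail, Fin.succ_pred]
        rw [ih (Fin.tail ys) (i.pred h0) (by rw [hi']; exact hi), mul_zero]

/-- a nonzero pair factor `R_{l,l′}C_{l′}h_{l′}` has `R_{l,l′} ≠ 0`. [cite: Balaban1983RegularityDecay, (5.17) p.595] -/
theorem rPair_ne_zero_of_bFac_ne_zero {q : ↥(labels M Λ) × ↥(labels M Λ)}
    (h : bFac A (pFam N M Λ) (hFam N M Λ) (cFam M A) q ≠ 0) : rPair A (pFam N M Λ) (hFam N M Λ) q.1 q.2 ≠ 0 := by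
  intro hz
  apply h
  unfold bFac
  rw [hz, zero_mul, zero_mul]

/-- a nonzero walk term of (5.17) has every pair factor nonzero. [cite: Balaban1983RegularityDecay, (5.17) p.595] -/
theorem bFac_ne_zero_of_term_ne_zero (cc : LTup M Λ) (h : term M A cc ≠ 0) (i : Fin cc.1) :
    bFac A (pFam N M Λ) (hFam N M Λ) (cFam M A) (cc.2.2 i) ≠ 0 := by
  intro hz
  apply h
  unfold term walkTerm517
  rw [bprod_eq_zero_of_eq_zero _ cc.1 cc.2.2 i hz, mul_zero]

/-! ## §3 Contributing walks are walks for the adjacency «labels within `ρ_A/M + 2`» -/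

/-- the label adjacency of the walks of a finite-range operator: `|l − l′|_∞ ≤ t` (label units).
[cite: BalabanImbrieJaffe1988, (2.42) p.264 ("ω is a walk on a lattice of spacing M")] -/
def NearLab (t : ℝ) (l l' : ↥(labels (d := d) M Λ)) : Prop := dL l l' ≤ t

/-- [6]'s adjacency `max_μ|l_μ − l′_μ| ≤ 1` of the even steps implies `|l − l′|_∞ ≤ 1`. [cite:
Balaban1983RegularityDecay, (5.17) p.595] -/
theorem dL_le_one_of_adj {l l' : ↥(labels (d := d) M Λ)} (h : Adj l.1 l'.1) : dL l l' ≤ 1 := by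
  unfold dL
  refine (dist_pi_le_iff zero_le_one).mpr fun μ => ?_
  rw [Int.dist_eq]
  exact_mod_cast h μ

/-- the walk condition from its consecutive-point form. [cite: BalabanImbrieJaffe1988, (2.42) p.264] -/
theorem isWalk_of_ptAt {ι : Type*} {adj : ι → ι → Prop} {j : ι} {n : ℕ} {ys : Fin n → ι}
    (h : ∀ k : ℕ, k < n → adj (ptAt j ys k) (ptAt j ys (k + 1))) : IsWalk adj j ys := by
  intro k
  rw [cons_castSucc_eq_ptAt, ← ptAt_succ j ys k]
  exact h k k.2

/-- **EVERY CONTRIBUTING WALK IS A `NearLab (ρ_A/M + 2)`-WALK**: if `C_ω[A](x₁, x₂) ≠ 0` for an operator `A` of finite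
range `ρ_A`, consecutive labels of `ω` are within `ρ_A/M + 2` — the even steps `(ω_{2i}, ω_{2i+1})` by the chain
condition of (5.17), the odd steps `(ω_{2i+1}, ω_{2i+2})` because `R_{ω_{2i+1},ω_{2i+2}} ≠ 0`. [cite: BalabanImbrieJaffe1988,
(2.42) p.264, (2.37) p.264] -/
theorem isNN_of_latticeCw_ne_zero (hM : 0 < M) {ρA : ℝ} (hρ : 0 ≤ ρA)
    (hA : ∀ p q : B4.Idx Λ N, ρA < dist (p.1 : Fin d → ℤ) (q.1 : Fin d → ℤ) → A p q = 0)
    {ω : Walk ↥(labels M Λ)} {x₁ x₂ : B4.Idx Λ N} (h : latticeCw M Λ N A ω x₁ x₂ ≠ 0) :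
    ω.IsNN (NearLab (ρA / M + 2)) := by
  have hMr : (0 : ℝ) < M := by exact_mod_cast hM
  by_cases hr : ∃ cc : LTup M Λ, flatten cc = ω
  · obtain ⟨cc, rfl⟩ := hr
    rw [latticeCw_flatten'] at h
    have hT : term M A cc ≠ 0 := fun hz => h (by rw [hz]; rfl)
    have hchain := isChain_of_term_ne_zero hM A cc hT
    change IsWalk (NearLab (ρA / M + 2)) cc.2.1 (flatten cc).steps
    refine isWalk_of_ptAt fun k hk => ?_
    change dL (pt cc k) (pt cc (k + 1)) ≤ ρA / M + 2
    have hk' : k < 2 * cc.1 := hk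
    obtain ⟨i, hi⟩ | ⟨i, hi⟩ := Nat.even_or_odd k
    · -- even step: the chain condition of (5.17)
      have hin : i < cc.1 := by omega
      have hc := hchain ⟨i, hin⟩
      have e1 : 2 * i = k := by omega
      simp only [e1] at hc
      have h1 : dL (pt cc k) (pt cc (k + 1)) ≤ 1 := dL_le_one_of_adj hc
      have h2 : (1 : ℝ) ≤ ρA / M + 2 := by
        have : 0 ≤ ρA / M := div_nonneg hρ hMr.le
        linarith
      exact h1.trans h2
    · -- odd step: an `R`-pair
      have hin : i < cc.1 := by omega
      have e1 : pt cc k = (cc.2.2 ⟨i, hin⟩).1 := by rw [hi]; exact pt_odd cc ⟨i, hin⟩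
      have e2 : pt cc (k + 1) = (cc.2.2 ⟨i, hin⟩).2 := by
        rw [hi, show 2 * i + 1 + 1 = 2 * i + 2 by ring]; exact pt_even_succ cc ⟨i, hin⟩
      rw [e1, e2]
      exact dL_le_of_rPair_ne_zero hM hρ hA
        (rPair_ne_zero_of_bFac_ne_zero (bFac_ne_zero_of_term_ne_zero cc hT ⟨i, hin⟩))
  · exfalso
    apply h
    have hz : latticeCw M Λ N A ω = 0 := by
      unfold latticeCw
      exact Function.extend_apply' _ _ _ hr
    rw [hz]
    rfl

/-! ## §4 Range shorter than `r(e_k) − M`: the regions are connected -/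

variable {s : ℕ}

/-- labels within `t < s + 1` of each other lie in touching `r(e_k)`-cubes (cubes of `s` labels a side).
[cite: BalabanImbrieJaffe1988, (2.44) p.264] -/
theorem touch_of_near (hs : 0 < s) {t : ℝ} (ht : t < s + 1) {l l' : ↥(labels (d := d) M Λ)} (h : NearLab t l l') :
    cubeOf M s l = cubeOf M s l' ∨ touch (cubeOf M s l) (cubeOf M s l') ∨ touch (cubeOf M s l') (cubeOf M s l) := by
  refine Or.inr (Or.inl ?_)
  by_contra hnt
  have h1 := dL_ge_of_not_touch hs hnt
  have h2 : dL l l' ≤ t := h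
  linarith

/-- **THE REGION OF A CONTRIBUTING WALK IS CONNECTED** ((2.44) *"Let X be a connected union of r(e_k)-cubes"*, for the
`ℤ^d` operators of [6] of finite range): if `A(x,x′) = 0` for `|x − x′|_∞ > ρ_A` with `ρ_A/M + 2 < s + 1` (range
shorter than `r(e_k) − M`), then for every walk `ω` with `C_ω[A](x₁, x₂) ≠ 0` the cube graph (adjacency `touch`) induced on
`X(ω) = region ω` is connected. [cite: BalabanImbrieJaffe1988, (2.44) p.264] -/
theorem region_connected_lattice (hM : 0 < M) (hs : 0 < s) {ρA : ℝ} (hρ : 0 ≤ ρA) (hρs : ρA / M + 2 < s + 1)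
    (hA : ∀ p q : B4.Idx Λ N, ρA < dist (p.1 : Fin d → ℤ) (q.1 : Fin d → ℤ) → A p q = 0)
    {ω : Walk ↥(labels M Λ)} {x₁ x₂ : B4.Idx Λ N} (h : latticeCw M Λ N A ω x₁ x₂ ≠ 0) :
    ((SimpleGraph.fromRel touch).induce (↑(region (cubeOf M s) touch ω) : Set (Cubes M s Λ))).Connected :=
  region_connected (cubeOf M s) touch (NearLab (ρA / M + 2)) (fun _ _ hll => touch_of_near hs hρs hll) ω
    (isNN_of_latticeCw_ne_zero hM hρ hA h)

/-- **(2.44) FOR THE `ℤ^d` OPERATORS OF [6]: ONLY CONNECTED `X` CARRY A PART `C^{(k)}_{Λ,X}`** — under the finite range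
`ρ_A` of `A` with `ρ_A/M + 2 < s + 1`, `C_{Λ,X}[A](x₁, x₂) ≠ 0` implies that `X` is a connected union of `r(e_k)`-cubes
(cube graph of `touch` induced on `X` connected), for every radius `ρ` and all `x₁, x₂`. [cite: BalabanImbrieJaffe1988,
(2.44) p.264] -/
theorem cX_lattice_ne_zero_connected (hM : 0 < M) (hs : 0 < s) {ρA : ℝ} (hρ : 0 ≤ ρA) (hρs : ρA / M + 2 < s + 1)
    (hA : ∀ p q : B4.Idx Λ N, ρA < dist (p.1 : Fin d → ℤ) (q.1 : Fin d → ℤ) → A p q = 0) (ρ : ℝ)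
    {X : Finset (Cubes (d := d) M s Λ)} {x₁ x₂ : B4.Idx Λ N}
    (h : cX (ldist (N := N) M) ρ (cubeOf M s) touch (fun ω y₁ y₂ => latticeCw M Λ N A ω y₁ y₂) X x₁ x₂ ≠ 0) :
    ((SimpleGraph.fromRel touch).induce (↑X : Set (Cubes M s Λ))).Connected :=
  cX_ne_zero_connected (ldist (N := N) M) ρ (cubeOf M s) touch (NearLab (ρA / M + 2))
    (fun _ _ hll => touch_of_near hs hρs hll) (fun _ _ _ hne => isNN_of_latticeCw_ne_zero hM hρ hA hne) h

open Classical in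
/-- hence the typed sum over ALL cube sets `X` in (2.45) IS the printed sum over the connected ones.
[cite: BalabanImbrieJaffe1988, (2.45) p.264, (2.44) p.264] -/
theorem sum_cX_eq_sum_connected (hM : 0 < M) (hs : 0 < s) {ρA : ℝ} (hρ : 0 ≤ ρA) (hρs : ρA / M + 2 < s + 1)
    (hA : ∀ p q : B4.Idx Λ N, ρA < dist (p.1 : Fin d → ℤ) (q.1 : Fin d → ℤ) → A p q = 0) (ρ : ℝ)
    (x₁ x₂ : B4.Idx Λ N) :
    ∑ X : Finset (Cubes (d := d) M s Λ), cX (ldist (N := N) M) ρ (cubeOf M s) touch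
        (fun ω y₁ y₂ => latticeCw M Λ N A ω y₁ y₂) X x₁ x₂
      = ∑ X ∈ Finset.univ.filter (fun X : Finset (Cubes (d := d) M s Λ) =>
            ((SimpleGraph.fromRel touch).induce (↑X : Set (Cubes M s Λ))).Connected),
          cX (ldist (N := N) M) ρ (cubeOf M s) touch (fun ω y₁ y₂ => latticeCw M Λ N A ω y₁ y₂) X x₁ x₂ := by
  refine (Finset.sum_subset (Finset.filter_subset _ _) fun X _ hX => ?_).symm
  by_contra hne
  exact hX (Finset.mem_filter.mpr ⟨Finset.mem_univ _, cX_lattice_ne_zero_connected hM hs hρ hρs hA ρ hne⟩)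

end Literature.MathematicalPhysics.QuantumFieldTheory.BalabanImbrieJaffe1984to88.BIJ88Connected244Lattice
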